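import Mathlib.RingTheory.MvPolynomial.EulerIdentity
import Literature.Computability.AlgebraicComplexity.MS21ANFFirstDerivativeHitting
import Literature.Computability.AlgebraicComplexity.MS21ANFSeparation
import HarnessLib

/-!
# Medini–Shpilka 2021, Lemmas 5.14–5.15: hitting second-order derivatives of an ANF orbit

Topic `Literature/Computability/AlgebraicComplexity` (cell `val-lit`, row X6-MS21; support brick for
the discharge of `MS2021_thm_35`, consortium owner x5). Theorem-only file (no definitions, no named
facts). Source: D. Medini, A. Shpilka, *Hitting sets and reconstruction for dense orbits in VP_e and
ΣΠΣ circuits*, CCC 2021 / arXiv:2102.05632 [MediniShpilka2021], §5.2.1, Lemma 5.14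
(`lem:hitSecondDeriv`, arXiv p0029:L27–p0029:L60) and Lemma 5.15 (`lem:pitDerivRoanf`, p0030:L1–L26).

* **Lemma 5.14 (kernel form, `exists_kill_pderivs_eq_C_mul_rop`).** For `Δ ≥ 2` and a nonzero
  combination `P = Σ_{i,j} α_{ij} ∂²ANF_Δ/∂x_i∂x_j`, there are coordinates `D` (`1 ≤ |D| ≤ 2`), a set
  `Z` (`|Z| ≤ 2`), a constant `c ≠ 0` and a nonzero read-once polynomial `Q` with
  `(∂_D P)|_{Z=0} = c · Q` (and `(∂_D ANF_Δ)|_{Z=0} = 0`). PROOF ROUTE: instead of the printed global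
  sibling/first-common-gate bookkeeping we induct on `Δ` over the block decomposition
  `ANF_{Δ+1} = A_b A_{1-b} + A_{b+2} A_{1-(b+2)}` (x5's `anf_succ_eq_block`): the second derivatives of
  `ANF_{Δ+1}` are `(∂∂A_b)·A_{1-b}` (same block), `(∂A_b)(∂A_{1-b})` (partner blocks) or `0`
  (`sum_pderiv_pderiv_anf_succ_eq`, on p1's `pderiv_pderiv_anf_succ_same/_sib/_other`); if some partner-block coefficient `α_{ij} + α_{ji}` is nonzero
  (the printed case "`x_i ≠ sib(x_j)`" across blocks) we differentiate along the two SIBLING leaves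
  (x5's `exists_sibling_decomposition`) and kill `x_i, x_j` (`caseA`); otherwise the partner-block
  part cancels and `P = Σ_b A_{1-b} · (Σ α ∂∂A_b)`, and we either recurse inside a block (`Δ ≥ 3`,
  the extra clause `(∂_D ANF)|_{Z=0} = 0` killing the competing term) or, at `Δ = 2`, differentiate
  one leaf of the partner quadratic and kill one leaf of each monomial of the own quadratic (the
  printed "sibling quadratic" case) (`caseB`).
* **Lemma 5.15 / the consortium's L2D** (`bind₁_affSubst_sum_C_mul_pderiv_pderiv_anf_ne_zero`):
  `(Σ α_{ij} ∂_i∂_j ANF_Δ)(Ax+b) ∘ G ≠ 0` for every `B`-independent `G` with `B ≥ t + 5`,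
  `4^Δ ≤ 2^t` (so `B = 2Δ+5` as printed), every field and every `Δ` — Lemma 5.14 feeds t18's engine
  `bind₁_affSubst_ne_zero_of_kill_pderivs_eq_prod` (two derivative blocks, two kill blocks, Thm 33 on
  the read-once product); and the printed `f`-level form `bind₁_dirDeriv_dirDeriv_affSubst_anf_ne_zero`
  (`∂²f/∂w∂u ∘ G ≠ 0` for `f = ANF_Δ(Ax+b)`), via the chain rule `dirDeriv_affSubst`.

HONEST FRAMING: support lemmas for a 2021 published theorem (MS Thm 35); `VP ≠ VNP` is NOT proved
and nothing here bears on it.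

## References

* [MediniShpilka2021] D. Medini, A. Shpilka, arXiv:2102.05632, Lemma 5.14 (p0029:L27-L60),
  Lemma 5.15 (p0030:L1-L26), Obs 5.8, Lemma 3.8-3.10, Thm 33.
-/

noncomputable section

open MvPolynomial

namespace Literature.Computability.AlgebraicComplexity

namespace MS2021

/-! ### Calculus: commuting derivatives, killing variables -/

section Calculus

variable {K : Type*} [Field K] {σ : Type*}

/-- Partial derivatives commute. [folklore] -/
private theorem pderiv_pderiv_comm (i j : σ) (p : MvPolynomial σ K) :
    pderiv i (pderiv j p) = pderiv j (pderiv i p) := by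
  classical
  by_cases hij : i = j
  · rw [hij]
  induction p using MvPolynomial.induction_on' with
  | monomial u a =>
      rw [pderiv_monomial, pderiv_monomial, pderiv_monomial, pderiv_monomial, tsub_right_comm]
      congr 1
      have h1 : (u - Finsupp.single j 1 : σ →₀ ℕ) i = u i := by
        rw [Finsupp.tsub_apply, Finsupp.single_eq_of_ne hij, tsub_zero]
      have h2 : (u - Finsupp.single i 1 : σ →₀ ℕ) j = u j := by
        rw [Finsupp.tsub_apply, Finsupp.single_eq_of_ne (Ne.symm hij), tsub_zero]
      rw [h1, h2]
      ring
  | add p q hp hq => rw [map_add, map_add, hp, hq, map_add, map_add]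

/-- Killing a set of variables `Z` (`x_w ↦ 0` for `w ∈ Z`) fixes a polynomial not involving them.
[folklore] -/
private theorem aeval_kill_eq_self_of_forall_notMem [DecidableEq σ] (Z : Finset σ) {p : MvPolynomial σ K}
    (h : ∀ w ∈ Z, w ∉ p.vars) :
    aeval (fun w => if w ∈ Z then (0 : MvPolynomial σ K) else X w) p = p := by
  have hfix : aeval (fun w => if w ∈ Z then (0 : MvPolynomial σ K) else X w) p = aeval X p := by
    refine MvPolynomial.hom_congr_vars (f₁ := (aeval _ : MvPolynomial σ K →ₐ[K] _).toRingHom)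
      (f₂ := (aeval X : MvPolynomial σ K →ₐ[K] _).toRingHom) ?_ (fun w hw _ => ?_) rfl
    · ext c
      simp
    · have hwZ : w ∉ Z := fun hz => h w hz hw
      simp [hwZ]
  rw [hfix, aeval_X_left_apply]

/-- Killing variables preserves read-once-ness (a killed leaf `αx_i + β` becomes the constant `β`).
[cite: MediniShpilka2021, Lemma 3.10 / proof of Lemma 5.15 (restrictions `ℓ_r = ℓ_m = 0` of ROPs)] -/
theorem IsROP.aeval_kill [DecidableEq σ] (Z : Finset σ) {S : Finset σ} {f : MvPolynomial σ K}
    (h : IsROP S f) : IsROP S (aeval (fun w => if w ∈ Z then (0 : MvPolynomial σ K) else X w) f) := by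
  induction h with
  | leaf i α β =>
      by_cases hi : i ∈ Z
      · have : aeval (fun w => if w ∈ Z then (0 : MvPolynomial σ K) else X w)
            (C α * X i + C β : MvPolynomial σ K) = C β := by
          simp [hi]
        rw [this]
        exact IsROP.const i β
      · have : aeval (fun w => if w ∈ Z then (0 : MvPolynomial σ K) else X w)
            (C α * X i + C β : MvPolynomial σ K) = C α * X i + C β := by
          simp [hi]
        rw [this]
        exact IsROP.leaf i α β
  | add α hf hg hd ihf ihg =>
      rw [map_add, map_add, algHom_C, MvPolynomial.algebraMap_eq]
      exact IsROP.add α ihf ihg hd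
  | mul α hf hg hd ihf ihg =>
      rw [map_add, map_mul, algHom_C, MvPolynomial.algebraMap_eq]
      exact IsROP.mul α ihf ihg hd

/-- A product of read-once polynomials on disjoint leaf sets is read-once. [cite: MediniShpilka2021, Def 5 (ROF, `×` gate)] -/
theorem IsROP.mul' {S₁ S₂ : Finset σ} [DecidableEq σ] {f g : MvPolynomial σ K} (hf : IsROP S₁ f)
    (hg : IsROP S₂ g) (hd : Disjoint S₁ S₂) : IsROP (S₁ ∪ S₂) (f * g) := by
  have h := IsROP.mul 0 hf hg hd
  rwa [C_0, add_zero] at h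

/-- A variable is a read-once polynomial. [cite: MediniShpilka2021, Def 5 (ROF, leaf)] -/
theorem IsROP.X' [DecidableEq σ] (i : σ) : IsROP ({i} : Finset σ) (X i : MvPolynomial σ K) := by
  have h : IsROP ({i} : Finset σ) (C (1 : K) * X i + C 0) := IsROP.leaf i 1 0
  rwa [C_1, one_mul, C_0, add_zero] at h

/-- `∂_k x_a = [k = a]`. [folklore] -/
private theorem pderiv_X_eq_ite [DecidableEq σ] (k a : σ) :
    pderiv k (X a : MvPolynomial σ K) = if k = a then 1 else 0 := by
  by_cases h : k = a
  · rw [if_pos h, h, pderiv_X_self]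
  · rw [if_neg h, pderiv_X_of_ne (Ne.symm h)]

/-- **One derivative, one kill**: for `G` free of `x_c` and of the killed variables `Z ∋ c`,
`(∂_i (x_c G))|_{Z=0} = [i = c] · G`. [cite: MediniShpilka2021, proof of Lemma 5.14 (arXiv p0029:L31-L40)] -/
theorem aeval_kill_pderiv_X_mul [DecidableEq σ] (Z : Finset σ) {c : σ} (hcZ : c ∈ Z)
    {G : MvPolynomial σ K} (hGZ : ∀ w ∈ Z, w ∉ G.vars) (i : σ) :
    aeval (fun w => if w ∈ Z then (0 : MvPolynomial σ K) else X w) (pderiv i (X c * G)) =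
      if i = c then G else 0 := by
  rw [pderiv_mul, pderiv_X_eq_ite, map_add, map_mul, map_mul, aeval_X, if_pos hcZ, zero_mul,
    add_zero]
  by_cases h : i = c
  · rw [if_pos h, if_pos h, map_one, one_mul, aeval_kill_eq_self_of_forall_notMem Z hGZ]
  · rw [if_neg h, if_neg h, map_zero, zero_mul]

/-- **Isolation by two derivatives and two kills**: for `W = x_a x_c G` with `G` free of the killed
variables `Z ∋ a, c` (`a ≠ c`), `(∂_i∂_j W)|_{Z=0} = [j = a][i = c]·G + [i = a][j = c]·G`.
[cite: MediniShpilka2021, proof of Lemma 5.14, first case (arXiv p0029:L31-L40)] -/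
theorem aeval_kill_pderiv_pderiv_X_mul_X_mul [DecidableEq σ] (Z : Finset σ) {a c : σ}
    (haZ : a ∈ Z) (hcZ : c ∈ Z) (hac : a ≠ c) {G : MvPolynomial σ K}
    (hGZ : ∀ w ∈ Z, w ∉ G.vars) (i j : σ) :
    aeval (fun w => if w ∈ Z then (0 : MvPolynomial σ K) else X w)
        (pderiv i (pderiv j (X a * X c * G))) =
      (if j = a then (if i = c then G else 0) else 0) +
        (if i = a then (if j = c then G else 0) else 0) := by
  have ha : a ∉ G.vars := hGZ a haZ
  have haH : a ∉ (X c * G : MvPolynomial σ K).vars := by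
    intro h
    rcases Finset.mem_union.mp (vars_mul _ _ h) with h1 | h1
    · rw [vars_X] at h1
      exact hac (Finset.mem_singleton.mp h1)
    · exact ha h1
  set kill : MvPolynomial σ K →ₐ[K] MvPolynomial σ K :=
    aeval (fun w => if w ∈ Z then (0 : MvPolynomial σ K) else X w) with hk
  have hXa : kill (X a) = 0 := by rw [hk, aeval_X, if_pos haZ]
  rw [mul_assoc]
  by_cases hja : j = a
  · have e1 : pderiv i (pderiv j (X a * (X c * G))) = pderiv i (X c * G) := by
      rw [hja, pderiv_mul, pderiv_X_self, one_mul, pderiv_eq_zero_of_notMem_vars haH, mul_zero,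
        add_zero]
    rw [e1, hk, aeval_kill_pderiv_X_mul Z hcZ hGZ i, if_pos hja]
    have hjc : ¬ j = c := fun h => hac (hja.symm.trans h)
    rw [if_neg hjc]
    simp
  · have e1 : pderiv i (pderiv j (X a * (X c * G))) =
        (if i = a then 1 else 0) * pderiv j (X c * G) + X a * pderiv i (pderiv j (X c * G)) := by
      rw [pderiv_mul, pderiv_X_of_ne (Ne.symm hja), zero_mul, zero_add, pderiv_mul, pderiv_X_eq_ite]
    rw [e1, map_add kill, map_mul kill, map_mul kill, hXa, zero_mul, add_zero, if_neg hja, zero_add]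
    by_cases hia : i = a
    · rw [if_pos hia, if_pos hia, map_one, one_mul, hk, aeval_kill_pderiv_X_mul Z hcZ hGZ j]
    · rw [if_neg hia, if_neg hia, map_zero, zero_mul]

end Calculus

/-! ### Iterated derivatives along a list of coordinates (t18's `foldr` convention) -/

section Foldr

variable {K : Type*} [Field K] {σ : Type*}

/-- Iterated derivatives are additive. [folklore] -/
private theorem foldr_pderiv_sum {ι : Type*} (L : List σ) (s : Finset ι) (g : ι → MvPolynomial σ K) :
    L.foldr (fun w p => pderiv w p) (∑ x ∈ s, g x) = ∑ x ∈ s, L.foldr (fun w p => pderiv w p) (g x) := by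
  induction L with
  | nil => rfl
  | cons y L ih => simp only [List.foldr_cons, ih, map_sum]

/-- Iterated derivatives commute with constants. [folklore] -/
private theorem foldr_pderiv_C_mul (L : List σ) (c : K) (q : MvPolynomial σ K) :
    L.foldr (fun w p => pderiv w p) (C c * q) = C c * L.foldr (fun w p => pderiv w p) q := by
  induction L with
  | nil => rfl
  | cons y L ih => simp only [List.foldr_cons, ih, pderiv_C_mul]

/-- Iterated derivatives of `0`. [folklore] -/
private theorem foldr_pderiv_zero (L : List σ) :
    L.foldr (fun w p => pderiv w p) (0 : MvPolynomial σ K) = 0 := by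
  induction L with
  | nil => rfl
  | cons y L ih => simp only [List.foldr_cons, ih, map_zero]

/-- Iterated derivatives of `f + g`. [folklore] -/
private theorem foldr_pderiv_add (L : List σ) (f g : MvPolynomial σ K) :
    L.foldr (fun w p => pderiv w p) (f + g) =
      L.foldr (fun w p => pderiv w p) f + L.foldr (fun w p => pderiv w p) g := by
  induction L with
  | nil => rfl
  | cons y L ih => simp only [List.foldr_cons, ih, map_add]

end Foldr

/-! ### Block calculus for `ANF_{Δ+1} = A_b A_{1-b} + A_{b+2} A_{1-(b+2)}` -/

section Blocks

variable {K : Type*} [Field K]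

/-- Summation over the variables of `ANF_{Δ+1}` by (block, position).
[cite: MediniShpilka2021, Def 8 / Def 5.4 (blocks of `ANF_{Δ+1}`)] -/
theorem sum_eq_sum_anfBlock {M : Type*} [AddCommMonoid M] (Δ : ℕ) (F : Fin (4 ^ (Δ + 1)) → M) :
    ∑ x, F x = ∑ b : Fin 4, ∑ a : Fin (4 ^ Δ), F (anfBlock Δ b a) := by
  rw [← Fintype.sum_prod_type']
  exact (Fintype.sum_equiv (finProdFinEquiv.trans (finCongr (pow_succ' 4 Δ).symm))
    (fun p : Fin 4 × Fin (4 ^ Δ) => F (anfBlock Δ p.1 p.2)) F (fun p => rfl)).symm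

/-- A sum over the four blocks, listed from a chosen block `b`: `b`, its partner `1 - b`, and the
other pair. [cite: MediniShpilka2021, Def 8] -/
theorem sum_fin_four_eq_blockwise {M : Type*} [AddCommMonoid M] (b : Fin 4) (g : Fin 4 → M) :
    ∑ b', g b' = g b + g (1 - b) + (g (b + 2) + g (1 - (b + 2))) := by
  rw [Fin.sum_univ_four]
  fin_cases b
  · simp only [Fin.zero_eta, Fin.isValue, sub_zero, zero_add]
    have h : (1 : Fin 4) - 2 = 3 := by decide
    rw [h, add_assoc]
  · simp only [Fin.mk_one, Fin.isValue, sub_self]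
    have h1 : (1 : Fin 4) + 2 = 3 := by decide
    have h2 : (1 : Fin 4) - 3 = 2 := by decide
    rw [h1, h2]
    abel
  · simp only [Fin.reduceFinMk, Fin.isValue]
    have h1 : (1 : Fin 4) - 2 = 3 := by decide
    have h2 : (2 : Fin 4) + 2 = 0 := by decide
    rw [h1, h2, sub_zero]
    abel
  · simp only [Fin.reduceFinMk, Fin.isValue]
    have h1 : (1 : Fin 4) - 3 = 2 := by decide
    have h2 : (3 : Fin 4) + 2 = 1 := by decide
    rw [h1, h2, sub_self]
    abel

/-- The partner block is another block. [cite: MediniShpilka2021, Def 8] -/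
theorem one_sub_ne_self (b : Fin 4) : 1 - b ≠ b := by revert b; decide

/-- The far blocks are other blocks. [cite: MediniShpilka2021, Def 8] -/
theorem add_two_ne_self (b : Fin 4) : b + 2 ≠ b ∧ b + 2 ≠ 1 - b ∧ 1 - (b + 2) ≠ b ∧ 1 - (b + 2) ≠ 1 - b := by
  revert b; decide

/-- **The second-derivative combination of `ANF_{Δ+1}`, blockwise**:
`Σ_{i,j} α_{ij} ∂_i∂_j ANF_{Δ+1} = Σ_b A_{1-b} · (Σ_{a,a'} α_{(b,a),(b,a')} ∂_a∂_{a'} ANF_Δ)^{(b)}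
  + Σ_b Σ_{a,a'} α_{(1-b,a'),(b,a)} (∂_{a'}ANF)^{(1-b)} (∂_a ANF)^{(b)}`.
[cite: MediniShpilka2021, Obs 5.8 and proof of Lemma 5.14 (arXiv p0029:L27-L60)] -/
theorem sum_pderiv_pderiv_anf_succ_eq (Δ : ℕ) (α : Fin (4 ^ (Δ + 1)) → Fin (4 ^ (Δ + 1)) → K) :
    (∑ i, ∑ j, C (α i j) * pderiv i (pderiv j (anf K (Δ + 1)))) =
      (∑ b : Fin 4, rename (anfBlock Δ (1 - b)) (anf K Δ) *
          rename (anfBlock Δ b) (∑ a, ∑ a', C (α (anfBlock Δ b a) (anfBlock Δ b a')) *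
            pderiv a (pderiv a' (anf K Δ)))) +
      ∑ b : Fin 4, ∑ a, ∑ a', C (α (anfBlock Δ (1 - b) a') (anfBlock Δ b a)) *
          (rename (anfBlock Δ (1 - b)) (pderiv a' (anf K Δ)) *
            rename (anfBlock Δ b) (pderiv a (anf K Δ))) := by
  -- inner index first
  rw [Finset.sum_comm, sum_eq_sum_anfBlock]
  rw [← Finset.sum_add_distrib]
  refine Finset.sum_congr rfl fun b _ => ?_
  -- for a fixed inner block `b`: sum over the inner position `a`, then split the outer block
  have hsplit : ∀ a : Fin (4 ^ Δ),
      (∑ i, C (α i (anfBlock Δ b a)) * pderiv i (pderiv (anfBlock Δ b a) (anf K (Δ + 1)))) =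
        (∑ a', C (α (anfBlock Δ b a') (anfBlock Δ b a)) *
            (rename (anfBlock Δ (1 - b)) (anf K Δ) *
              rename (anfBlock Δ b) (pderiv a' (pderiv a (anf K Δ))))) +
          ∑ a', C (α (anfBlock Δ (1 - b) a') (anfBlock Δ b a)) *
            (rename (anfBlock Δ (1 - b)) (pderiv a' (anf K Δ)) *
              rename (anfBlock Δ b) (pderiv a (anf K Δ))) := by
    intro a
    rw [sum_eq_sum_anfBlock, sum_fin_four_eq_blockwise b]
    obtain ⟨h1, h2, h3, h4⟩ := add_two_ne_self b
    simp only [pderiv_pderiv_anf_succ_same, pderiv_pderiv_anf_succ_sib,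
      pderiv_pderiv_anf_succ_other K Δ h1 h2, pderiv_pderiv_anf_succ_other K Δ h3 h4, mul_zero,
      Finset.sum_const_zero, add_zero]
  simp_rw [hsplit]
  rw [Finset.sum_add_distrib]
  congr 1
  -- the same-block part: pull `A_{1-b}` and the renaming out
  rw [map_sum, Finset.mul_sum, Finset.sum_comm]
  refine Finset.sum_congr rfl fun a _ => ?_
  rw [map_sum, Finset.mul_sum]
  refine Finset.sum_congr rfl fun a' _ => ?_
  rw [map_mul, rename_C]
  ring

/-- The partner-block part CANCELS when every cross coefficient `α_{(b,a),(1-b,a')} + α_{(1-b,a'),(b,a)}`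
vanishes (the situation "all non-zero summands are sibling pairs" of the printed proof, one level up).
[cite: MediniShpilka2021, proof of Lemma 5.14, second case (arXiv p0029:L42-L60)] -/
theorem cross_sum_eq_zero (Δ : ℕ) (α : Fin (4 ^ (Δ + 1)) → Fin (4 ^ (Δ + 1)) → K)
    (hγ : ∀ (b : Fin 4) (a a' : Fin (4 ^ Δ)),
      α (anfBlock Δ b a) (anfBlock Δ (1 - b) a') + α (anfBlock Δ (1 - b) a') (anfBlock Δ b a) = 0) :
    (∑ b : Fin 4, ∑ a, ∑ a', C (α (anfBlock Δ (1 - b) a') (anfBlock Δ b a)) *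
        (rename (anfBlock Δ (1 - b)) (pderiv a' (anf K Δ)) *
          rename (anfBlock Δ b) (pderiv a (anf K Δ)))) = 0 := by
  set h : Fin 4 → MvPolynomial (Fin (4 ^ (Δ + 1))) K := fun b =>
    ∑ a, ∑ a', C (α (anfBlock Δ (1 - b) a') (anfBlock Δ b a)) *
      (rename (anfBlock Δ (1 - b)) (pderiv a' (anf K Δ)) * rename (anfBlock Δ b) (pderiv a (anf K Δ)))
    with hh
  have hpair : ∀ b : Fin 4, h b + h (1 - b) = 0 := by
    intro b
    have e : h (1 - b) = ∑ a, ∑ a', C (α (anfBlock Δ b a) (anfBlock Δ (1 - b) a')) *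
        (rename (anfBlock Δ (1 - b)) (pderiv a' (anf K Δ)) *
          rename (anfBlock Δ b) (pderiv a (anf K Δ))) := by
      simp only [hh, sub_sub_cancel]
      rw [Finset.sum_comm]
      refine Finset.sum_congr rfl fun a _ => Finset.sum_congr rfl fun a' _ => ?_
      ring
    rw [e]
    simp only [hh]
    rw [← Finset.sum_add_distrib]
    refine Finset.sum_eq_zero fun a _ => ?_
    rw [← Finset.sum_add_distrib]
    refine Finset.sum_eq_zero fun a' _ => ?_
    have e0 : α (anfBlock Δ (1 - b) a') (anfBlock Δ b a) + α (anfBlock Δ b a) (anfBlock Δ (1 - b) a') = 0 :=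
      (add_comm _ _).trans (hγ b a a')
    rw [← add_mul, ← map_add, e0, C_0, zero_mul]
  show ∑ b, h b = 0
  rw [Fin.sum_univ_four]
  have h0 := hpair 0
  have h2 := hpair 2
  have e1 : (1 : Fin 4) - 0 = 1 := by decide
  have e3 : (1 : Fin 4) - 2 = 3 := by decide
  rw [e1] at h0
  rw [e3] at h2
  calc h 0 + h 1 + h 2 + h 3 = (h 0 + h 1) + (h 2 + h 3) := by ring
    _ = 0 := by rw [h0, h2, add_zero]

end Blocks

/-! ### More block calculus: variables, renamed kills, block-free polynomials -/

section Blocks2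

variable {K : Type*} [Field K]

/-- Variables of a renamed block polynomial lie in that block. [cite: MediniShpilka2021, Def 8] -/
theorem notMem_vars_rename_anfBlock_of_ne (Δ : ℕ) {b b' : Fin 4} (hb : b' ≠ b) (z : Fin (4 ^ Δ))
    (p : MvPolynomial (Fin (4 ^ Δ)) K) : anfBlock Δ b z ∉ (rename (anfBlock Δ b') p).vars := by
  classical
  intro h
  obtain ⟨y, -, hy⟩ := Finset.mem_image.mp (vars_rename _ _ h)
  exact hb (anfBlock_inj hy).1

/-- A non-variable of `p` stays a non-variable after renaming into the same block. [cite: MediniShpilka2021, Def 8] -/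
theorem notMem_vars_rename_anfBlock_self (Δ : ℕ) (b : Fin 4) {z : Fin (4 ^ Δ)}
    {p : MvPolynomial (Fin (4 ^ Δ)) K} (hz : z ∉ p.vars) :
    anfBlock Δ b z ∉ (rename (anfBlock Δ b) p).vars := by
  classical
  intro h
  obtain ⟨y, hy, hyz⟩ := Finset.mem_image.mp (vars_rename _ _ h)
  rw [(anfBlock_inj hyz).2] at hy
  exact hz hy

/-- Killing the image of `Z'` in block `b` commutes with renaming into block `b`.
[cite: MediniShpilka2021, Lemma 3.10 (kills) with Def 8 (blocks)] -/
theorem aeval_kill_rename_anfBlock (Δ : ℕ) (b : Fin 4) (Z' : Finset (Fin (4 ^ Δ)))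
    (p : MvPolynomial (Fin (4 ^ Δ)) K) :
    aeval (fun w => if w ∈ Z'.image (anfBlock Δ b) then (0 : MvPolynomial (Fin (4 ^ (Δ + 1))) K)
        else X w) (rename (anfBlock Δ b) p) =
      rename (anfBlock Δ b)
        (aeval (fun w => if w ∈ Z' then (0 : MvPolynomial (Fin (4 ^ Δ)) K) else X w) p) := by
  classical
  rw [aeval_rename]
  have h2 : (rename (anfBlock Δ b)).comp
      (aeval (fun w => if w ∈ Z' then (0 : MvPolynomial (Fin (4 ^ Δ)) K) else X w)) =
      aeval ((fun w => if w ∈ Z'.image (anfBlock Δ b) then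
        (0 : MvPolynomial (Fin (4 ^ (Δ + 1))) K) else X w) ∘ anfBlock Δ b) := by
    refine MvPolynomial.algHom_ext fun a => ?_
    rw [AlgHom.comp_apply, aeval_X, aeval_X, Function.comp_apply]
    by_cases ha : a ∈ Z'
    · rw [if_pos ha, if_pos ((anfBlock_injective Δ b).mem_finset_image.mpr ha), map_zero]
    · rw [if_neg ha, if_neg (fun h => ha ((anfBlock_injective Δ b).mem_finset_image.mp h)), rename_X]
  have := congrArg (fun φ => φ p) h2
  simpa only [AlgHom.comp_apply] using this.symm

/-- Killing variables of block `b` fixes a polynomial renamed into another block.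
[cite: MediniShpilka2021, Lemma 3.10 with Def 8] -/
theorem aeval_kill_image_rename_anfBlock_of_ne (Δ : ℕ) {b b' : Fin 4} (hb : b' ≠ b)
    (Z' : Finset (Fin (4 ^ Δ))) (p : MvPolynomial (Fin (4 ^ Δ)) K) :
    aeval (fun w => if w ∈ Z'.image (anfBlock Δ b) then (0 : MvPolynomial (Fin (4 ^ (Δ + 1))) K)
        else X w) (rename (anfBlock Δ b') p) = rename (anfBlock Δ b') p := by
  classical
  refine aeval_kill_eq_self_of_forall_notMem _ fun w hw => ?_
  obtain ⟨z, -, rfl⟩ := Finset.mem_image.mp hw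
  exact notMem_vars_rename_anfBlock_of_ne Δ hb z p

/-- Iterated derivatives along block-`b` coordinates of `S · R^{(b)}` with `S` free of block `b`:
only `R` is differentiated. [cite: MediniShpilka2021, Obs 5.8 / Lemma 3.9 iterated] -/
theorem foldr_pderiv_map_anfBlock_mul_rename (Δ : ℕ) (b : Fin 4) (L : List (Fin (4 ^ Δ)))
    (S : MvPolynomial (Fin (4 ^ (Δ + 1))) K) (hS : ∀ d, pderiv (anfBlock Δ b d) S = 0)
    (R : MvPolynomial (Fin (4 ^ Δ)) K) :
    (L.map (anfBlock Δ b)).foldr (fun w p => pderiv w p) (S * rename (anfBlock Δ b) R) =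
      S * rename (anfBlock Δ b) (L.foldr (fun w p => pderiv w p) R) := by
  induction L with
  | nil => rfl
  | cons y L ih =>
      rw [List.map_cons, List.foldr_cons, List.foldr_cons, ih, pderiv_mul, hS, zero_mul, zero_add,
        pderiv_anfBlock_rename_self]

/-- Iterated (at least one) derivatives along block-`b` coordinates kill a block-`b`-free polynomial.
[cite: MediniShpilka2021, Obs 5.8] -/
theorem foldr_pderiv_map_anfBlock_eq_zero (Δ : ℕ) (b : Fin 4) :
    ∀ (L : List (Fin (4 ^ Δ))), L ≠ [] → ∀ (S : MvPolynomial (Fin (4 ^ (Δ + 1))) K),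
      (∀ d, pderiv (anfBlock Δ b d) S = 0) →
      (L.map (anfBlock Δ b)).foldr (fun w p => pderiv w p) S = 0
  | [], h, _, _ => absurd rfl h
  | [y], _, S, hS => by
      rw [List.map_singleton, List.foldr_cons, List.foldr_nil, hS]
  | y :: y' :: L, _, S, hS => by
      rw [List.map_cons, List.foldr_cons,
        foldr_pderiv_map_anfBlock_eq_zero Δ b (y' :: L) (List.cons_ne_nil _ _) S hS, map_zero]

/-- A product of two polynomials renamed into blocks other than `b` is block-`b`-free.
[cite: MediniShpilka2021, Obs 5.8] -/
theorem pderiv_anfBlock_mul_rename_of_ne (Δ : ℕ) {b b₁ b₂ : Fin 4} (h₁ : b₁ ≠ b) (h₂ : b₂ ≠ b)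
    (p q : MvPolynomial (Fin (4 ^ Δ)) K) (d : Fin (4 ^ Δ)) :
    pderiv (anfBlock Δ b d) (rename (anfBlock Δ b₁) p * rename (anfBlock Δ b₂) q) = 0 := by
  rw [pderiv_mul, pderiv_anfBlock_rename_of_ne K h₁, pderiv_anfBlock_rename_of_ne K h₂, zero_mul,
    mul_zero, add_zero]

/-- Two renamed blocks are disjoint leaf sets. [cite: MediniShpilka2021, Def 8] -/
theorem disjoint_image_anfBlock (Δ : ℕ) {b b' : Fin 4} (hb : b ≠ b') (S S' : Finset (Fin (4 ^ Δ))) :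
    Disjoint (S.image (anfBlock Δ b)) (S'.image (anfBlock Δ b')) := by
  classical
  rw [Finset.disjoint_left]
  intro x hx hx'
  obtain ⟨y, -, rfl⟩ := Finset.mem_image.mp hx
  obtain ⟨y', -, h⟩ := Finset.mem_image.mp hx'
  exact hb (anfBlock_inj h).1.symm

/-- Renaming into a block preserves non-vanishing. [cite: MediniShpilka2021, Def 8] -/
theorem rename_anfBlock_ne_zero (Δ : ℕ) (b : Fin 4) {p : MvPolynomial (Fin (4 ^ Δ)) K} (hp : p ≠ 0) :
    rename (anfBlock Δ b) p ≠ 0 := fun h =>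
  hp (rename_injective _ (anfBlock_injective Δ b) (by rw [h, map_zero]))

/-- The partner leaf: if `ANF = x_i x_{i'} P + R` with `P, R` free of `x_i, x_{i'}` then
`∂_{i'} ANF = x_i P` and `P = ∂_{i'}∂_i ANF`. [cite: MediniShpilka2021, Obs 5.7-5.8 (siblings)] -/
theorem pderiv_eq_X_mul_of_sibling {σ : Type*} {F P R : MvPolynomial σ K} {i i' : σ} (hii' : i' ≠ i)
    (hF : F = X i * X i' * P + R) (hiP : i ∉ P.vars) (hi'P : i' ∉ P.vars) (hi'R : i' ∉ R.vars) :
    pderiv i' F = X i * P ∧ P = pderiv i' (pderiv i F) := by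
  classical
  have hPi : pderiv i P = 0 := pderiv_eq_zero_of_notMem_vars hiP
  have hPi' : pderiv i' P = 0 := pderiv_eq_zero_of_notMem_vars hi'P
  have hRi' : pderiv i' R = 0 := pderiv_eq_zero_of_notMem_vars hi'R
  constructor
  · rw [hF, map_add, pderiv_mul, pderiv_mul, pderiv_X_of_ne (Ne.symm hii'), pderiv_X_self, hPi', hRi']
    ring
  · rw [hF, map_add, map_add, pderiv_pderiv_comm i' i R, hRi', map_zero, add_zero]
    rw [pderiv_mul, pderiv_mul, pderiv_X_self, pderiv_X_of_ne hii', hPi]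
    simp only [mul_zero, add_zero, one_mul]
    rw [pderiv_mul, pderiv_X_self, hPi', mul_zero, add_zero, one_mul]

end Blocks2

/-! ### Lemma 5.14, case "a non-sibling pair" (here: a partner-block pair) -/

section CaseA

variable {K : Type*} [Field K]

/-- **Lemma 5.14, first case** (one level above the leaves): if the combination
`P = Σ α_{ij} ∂_i∂_j ANF_{Δ+2}` has a nonzero cross coefficient `α_{i₀j₀} + α_{j₀i₀}` for `x_{i₀}`, `x_{j₀}`
in partner blocks `b`, `1-b`, then with `D = {sib(i₀), sib(j₀)}` and `Z = {i₀, j₀}`: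
`(∂_D P)|_{Z=0} = (α_{i₀j₀} + α_{j₀i₀}) · G`, `G` a nonzero read-once product, and `(∂_D ANF)|_{Z=0} = 0`.
[cite: MediniShpilka2021, proof of Lemma 5.14, first case (arXiv p0029:L29-L40)] -/
theorem exists_kill_pderivs_of_cross_ne_zero (Δ : ℕ)
    (α : Fin (4 ^ (Δ + 1 + 1)) → Fin (4 ^ (Δ + 1 + 1)) → K) (b : Fin 4) (a₀ a₁ : Fin (4 ^ (Δ + 1)))
    (hγ : α (anfBlock (Δ + 1) b a₀) (anfBlock (Δ + 1) (1 - b) a₁) +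
      α (anfBlock (Δ + 1) (1 - b) a₁) (anfBlock (Δ + 1) b a₀) ≠ 0) :
    ∃ (L : List (Fin (4 ^ (Δ + 1 + 1)))) (Z : Finset (Fin (4 ^ (Δ + 1 + 1)))) (c : K)
      (S : Finset (Fin (4 ^ (Δ + 1 + 1)))) (Q : MvPolynomial (Fin (4 ^ (Δ + 1 + 1))) K),
      1 ≤ L.length ∧ L.length ≤ 2 ∧ Z.card ≤ 2 ∧ c ≠ 0 ∧ IsROP S Q ∧ Q ≠ 0 ∧
      aeval (fun w => if w ∈ Z then (0 : MvPolynomial (Fin (4 ^ (Δ + 1 + 1))) K) else X w)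
        (L.foldr (fun w p => pderiv w p)
          (∑ i, ∑ j, C (α i j) * pderiv i (pderiv j (anf K (Δ + 1 + 1))))) = C c * Q ∧
      aeval (fun w => if w ∈ Z then (0 : MvPolynomial (Fin (4 ^ (Δ + 1 + 1))) K) else X w)
        (L.foldr (fun w p => pderiv w p) (anf K (Δ + 1 + 1))) = 0 := by
  classical
  -- sibling decompositions of `ANF_{Δ+1}` at `a₀` and at `a₁`
  obtain ⟨a₀', ha₀', P₀, R₀, hdec₀, hP₀, ha₀P, ha₀'P, -, ha₀'R⟩ :=
    exists_sibling_decomposition K Δ a₀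
  obtain ⟨a₁', ha₁', P₁, R₁, hdec₁, hP₁, ha₁P, ha₁'P, -, ha₁'R⟩ :=
    exists_sibling_decomposition K Δ a₁
  obtain ⟨hd₀, hP₀eq⟩ := pderiv_eq_X_mul_of_sibling ha₀' hdec₀ ha₀P ha₀'P ha₀'R
  obtain ⟨hd₁, hP₁eq⟩ := pderiv_eq_X_mul_of_sibling ha₁' hdec₁ ha₁P ha₁'P ha₁'R
  set blk := anfBlock (Δ + 1) with hblk
  set i₀ := blk b a₀ with hi₀
  set i₀' := blk b a₀' with hi₀'
  set j₀ := blk (1 - b) a₁ with hj₀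
  set j₀' := blk (1 - b) a₁' with hj₀'
  set G : MvPolynomial (Fin (4 ^ (Δ + 1 + 1))) K := rename (blk b) P₀ * rename (blk (1 - b)) P₁ with hG
  have hij : i₀ ≠ j₀ := fun h => (one_sub_ne_self b).symm (anfBlock_inj h).1
  -- the key identity `∂_{j₀'} ∂_{i₀'} ANF_{Δ+2} = x_{i₀} x_{j₀} G`
  have hkey : pderiv j₀' (pderiv i₀' (anf K (Δ + 1 + 1))) = X i₀ * X j₀ * G := by
    rw [hj₀', hi₀', hblk, pderiv_pderiv_anf_succ_sib, hd₀, hd₁, map_mul, map_mul, rename_X,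
      rename_X]
    rw [hG]
    ring
  -- `G` is free of `x_{i₀}, x_{j₀}`
  have hGZ : ∀ w ∈ ({i₀, j₀} : Finset (Fin (4 ^ (Δ + 1 + 1)))), w ∉ G.vars := by
    intro w hw hwG
    rcases Finset.mem_union.mp (vars_mul _ _ hwG) with h | h
    · rcases Finset.mem_insert.mp hw with rfl | hw
      · exact notMem_vars_rename_anfBlock_self (Δ + 1) b ha₀P h
      · rw [Finset.mem_singleton] at hw
        rw [hw] at h
        exact notMem_vars_rename_anfBlock_of_ne (Δ + 1) (one_sub_ne_self b).symm a₁ P₀ h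
    · rcases Finset.mem_insert.mp hw with rfl | hw
      · exact notMem_vars_rename_anfBlock_of_ne (Δ + 1) (one_sub_ne_self b) a₀ P₁ h
      · rw [Finset.mem_singleton] at hw
        rw [hw] at h
        exact notMem_vars_rename_anfBlock_self (Δ + 1) (1 - b) ha₁P h
  have hG0 : G ≠ 0 :=
    mul_ne_zero (rename_anfBlock_ne_zero _ _ hP₀) (rename_anfBlock_ne_zero _ _ hP₁)
  -- read-once structure of `G`
  have hROP₀ : IsROP (Finset.univ : Finset (Fin (4 ^ (Δ + 1)))) P₀ := by
    rw [hP₀eq]; exact ((isROP_anf K (Δ + 1)).isROP_pderiv a₀).isROP_pderiv a₀'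
  have hROP₁ : IsROP (Finset.univ : Finset (Fin (4 ^ (Δ + 1)))) P₁ := by
    rw [hP₁eq]; exact ((isROP_anf K (Δ + 1)).isROP_pderiv a₁).isROP_pderiv a₁'
  have hROPG : IsROP (Finset.univ.image (blk b) ∪ Finset.univ.image (blk (1 - b))) G :=
    IsROP.mul' (hROP₀.rename _ (anfBlock_injective _ _)) (hROP₁.rename _ (anfBlock_injective _ _))
      (disjoint_image_anfBlock _ (one_sub_ne_self b).symm _ _)
  refine ⟨[j₀', i₀'], {i₀, j₀}, α i₀ j₀ + α j₀ i₀, _, G, by simp, by simp,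
    (Finset.card_insert_le _ _).trans (by simp), hγ, hROPG, hG0, ?_, ?_⟩
  · -- the combination: only the pairs `{i, j} = {i₀, j₀}` survive
    simp only [List.foldr_cons, List.foldr_nil]
    simp_rw [map_sum, pderiv_C_mul, map_mul, algHom_C, MvPolynomial.algebraMap_eq]
    have hT : ∀ i j, aeval (fun w => if w ∈ ({i₀, j₀} : Finset (Fin (4 ^ (Δ + 1 + 1)))) then
          (0 : MvPolynomial (Fin (4 ^ (Δ + 1 + 1))) K) else X w)
          (pderiv j₀' (pderiv i₀' (pderiv i (pderiv j (anf K (Δ + 1 + 1)))))) =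
        (if j = i₀ then (if i = j₀ then G else 0) else 0) +
          (if i = i₀ then (if j = j₀ then G else 0) else 0) := by
      intro i j
      rw [pderiv_pderiv_comm i₀' i, pderiv_pderiv_comm j₀' i, pderiv_pderiv_comm i₀' j,
        pderiv_pderiv_comm j₀' j, hkey]
      exact aeval_kill_pderiv_pderiv_X_mul_X_mul _ (by simp) (by simp) hij hGZ i j
    simp_rw [hT, mul_add, Finset.sum_add_distrib]
    have h1 : (∑ i, ∑ j, C (α i j) * (if j = i₀ then (if i = j₀ then G else 0) else 0)) =
        C (α j₀ i₀) * G := by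
      rw [Finset.sum_eq_single_of_mem j₀ (Finset.mem_univ _)
        (fun i _ hi => Finset.sum_eq_zero fun j _ => by simp [hi])]
      rw [Finset.sum_eq_single_of_mem i₀ (Finset.mem_univ _) (fun j _ hj => by simp [hj])]
      simp
    have h2 : (∑ i, ∑ j, C (α i j) * (if i = i₀ then (if j = j₀ then G else 0) else 0)) =
        C (α i₀ j₀) * G := by
      rw [Finset.sum_eq_single_of_mem i₀ (Finset.mem_univ _)
        (fun i _ hi => Finset.sum_eq_zero fun j _ => by simp [hi])]
      rw [Finset.sum_eq_single_of_mem j₀ (Finset.mem_univ _) (fun j _ hj => by simp [hj])]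
      simp
    rw [h1, h2, map_add]
    ring
  · simp only [List.foldr_cons, List.foldr_nil]
    rw [hkey, map_mul, map_mul, aeval_X, if_pos (by simp)]
    simp

end CaseA

/-! ### Lemma 5.14, case "only sibling pairs": the base level and the inductive lift -/

section CaseB

variable {K : Type*} [Field K]

/-- At depth one above the leaves every second-derivative combination of `ANF_1` is a constant.
[cite: MediniShpilka2021, Lemma 5.14 (the hypothesis `Δ ≥ 2`; at `Δ = 1` the combination is constant)] -/
theorem sum_C_mul_pderiv_pderiv_anf_one_eq_C (β : Fin (4 ^ (0 + 1)) → Fin (4 ^ (0 + 1)) → K) :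
    (∑ i, ∑ j, C (β i j) * pderiv i (pderiv j (anf K (0 + 1)))) =
      C (coeff 0 (∑ i, ∑ j, C (β i j) * pderiv i (pderiv j (anf K (0 + 1))))) := by
  have hhom : (∑ i, ∑ j, C (β i j) * pderiv i (pderiv j (anf K (0 + 1)))).IsHomogeneous 0 := by
    refine IsHomogeneous.sum _ _ _ fun i _ => IsHomogeneous.sum _ _ _ fun j _ => ?_
    have h2 := ((isHomogeneous_anf K (0 + 1)).pderiv (i := j)).pderiv (i := i)
    norm_num at h2
    exact h2.C_mul _
  exact totalDegree_eq_zero_iff_eq_C.mp (Nat.le_zero.mp hhom.totalDegree_le)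

/-- **Lemma 5.14, second case, at the bottom** (`ANF_2`, all cross coefficients cancel): the
combination is `Σ_b c_b · q_{1-b}` over the four leaf quadratics; differentiate one leaf of `q_{1-b₀}`
(`c_{b₀} ≠ 0`) and kill one leaf of each monomial of the partner quadratic `q_{b₀}`.
[cite: MediniShpilka2021, proof of Lemma 5.14, second case (arXiv p0029:L42-L60)] -/
theorem exists_kill_pderivs_of_cross_eq_zero_base
    (α : Fin (4 ^ (0 + 1 + 1)) → Fin (4 ^ (0 + 1 + 1)) → K)
    (hγ : ∀ (b : Fin 4) (a a' : Fin (4 ^ (0 + 1))), α (anfBlock (0 + 1) b a) (anfBlock (0 + 1) (1 - b) a') +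
      α (anfBlock (0 + 1) (1 - b) a') (anfBlock (0 + 1) b a) = 0)
    (hf : (∑ i, ∑ j, C (α i j) * pderiv i (pderiv j (anf K (0 + 1 + 1)))) ≠ 0) :
    ∃ (L : List (Fin (4 ^ (0 + 1 + 1)))) (Z : Finset (Fin (4 ^ (0 + 1 + 1)))) (c : K)
      (S : Finset (Fin (4 ^ (0 + 1 + 1)))) (Q : MvPolynomial (Fin (4 ^ (0 + 1 + 1))) K),
      1 ≤ L.length ∧ L.length ≤ 2 ∧ Z.card ≤ 2 ∧ c ≠ 0 ∧ IsROP S Q ∧ Q ≠ 0 ∧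
      aeval (fun w => if w ∈ Z then (0 : MvPolynomial (Fin (4 ^ (0 + 1 + 1))) K) else X w)
        (L.foldr (fun w p => pderiv w p)
          (∑ i, ∑ j, C (α i j) * pderiv i (pderiv j (anf K (0 + 1 + 1))))) = C c * Q ∧
      aeval (fun w => if w ∈ Z then (0 : MvPolynomial (Fin (4 ^ (0 + 1 + 1))) K) else X w)
        (L.foldr (fun w p => pderiv w p) (anf K (0 + 1 + 1))) = 0 := by
  classical
  -- the blockwise expansion, the cross part cancels
  have hE := sum_pderiv_pderiv_anf_succ_eq (K := K) (0 + 1) α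
  rw [cross_sum_eq_zero (0 + 1) α hγ, add_zero] at hE
  -- every same-block combination is a constant `c_b`
  set cb : Fin 4 → K := fun b => coeff 0 (∑ a, ∑ a',
    C (α (anfBlock (0 + 1) b a) (anfBlock (0 + 1) b a')) * pderiv a (pderiv a' (anf K (0 + 1)))) with hcb
  have hE' : (∑ i, ∑ j, C (α i j) * pderiv i (pderiv j (anf K (0 + 1 + 1)))) =
      ∑ b : Fin 4, rename (anfBlock (0 + 1) (1 - b)) (anf K (0 + 1)) * C (cb b) := by
    rw [hE]
    refine Finset.sum_congr rfl fun b _ => ?_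
    rw [sum_C_mul_pderiv_pderiv_anf_one_eq_C, rename_C]
  -- some `c_{b₀} ≠ 0`
  obtain ⟨b₀, hb₀⟩ : ∃ b₀, cb b₀ ≠ 0 := by
    by_contra hall
    push Not at hall
    apply hf
    rw [hE']
    simp [hall]
  -- the leaf quadratic `ANF_1 = x₀x₁ + x₂x₃`
  set z : Fin (4 ^ 0) := ⟨0, by norm_num⟩ with hz
  have hanf0 : anf K 0 = X z := by simp only [anf, hz]
  have hanf1 : anf K (0 + 1) = X (anfBlock 0 0 z) * X (anfBlock 0 1 z) +
      X (anfBlock 0 2 z) * X (anfBlock 0 3 z) := by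
    rw [anf_succ, hanf0]
    simp only [rename_X]
  have hne : ∀ b b' : Fin 4, b ≠ b' → anfBlock 0 b z ≠ anfBlock 0 b' z :=
    fun b b' h e => h (anfBlock_inj e).1
  have hd1 : pderiv (anfBlock 0 0 z) (anf K (0 + 1)) = X (anfBlock 0 1 z) := by
    rw [hanf1, map_add, pderiv_mul, pderiv_mul, pderiv_X_self,
      pderiv_X_of_ne (hne 1 0 (by decide)), pderiv_X_of_ne (hne 2 0 (by decide)),
      pderiv_X_of_ne (hne 3 0 (by decide))]
    ring
  set Bk := anfBlock (0 + 1) with hBk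
  set k := Bk (1 - b₀) (anfBlock 0 0 z) with hk
  set l := Bk (1 - b₀) (anfBlock 0 1 z) with hl
  set Z : Finset (Fin (4 ^ (0 + 1 + 1))) := {Bk b₀ (anfBlock 0 0 z), Bk b₀ (anfBlock 0 2 z)} with hZ
  have hlZ : l ∉ Z := by
    rw [hZ, Finset.mem_insert, Finset.mem_singleton]
    rintro (h | h)
    · exact one_sub_ne_self b₀ (anfBlock_inj h).1
    · exact one_sub_ne_self b₀ (anfBlock_inj h).1
  have hkillA : aeval (fun w => if w ∈ Z then (0 : MvPolynomial (Fin (4 ^ (0 + 1 + 1))) K) else X w)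
      (rename (Bk b₀) (anf K (0 + 1))) = 0 := by
    have h0 : Bk b₀ (anfBlock 0 0 z) ∈ Z := by rw [hZ]; simp
    have h2 : Bk b₀ (anfBlock 0 2 z) ∈ Z := by rw [hZ]; simp
    rw [hanf1, map_add, map_mul, map_mul, rename_X, rename_X, rename_X, rename_X, map_add, map_mul,
      map_mul, aeval_X, aeval_X, aeval_X, aeval_X, if_pos h0, if_pos h2, zero_mul, zero_mul, add_zero]
  have hdk : ∀ b : Fin 4, pderiv k (rename (anfBlock (0 + 1) (1 - b)) (anf K (0 + 1))) =
      if b = b₀ then X l else 0 := by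
    intro b
    by_cases hb : b = b₀
    · rw [if_pos hb, hb, hk, hBk, pderiv_anfBlock_rename_self, hd1, rename_X]
    · have hb' : 1 - b ≠ 1 - b₀ := fun e => hb (sub_right_injective e)
      rw [if_neg hb, hk, hBk, pderiv_anfBlock_rename_of_ne K hb']
  refine ⟨[k], Z, cb b₀, {l}, X l, by simp, by simp, (Finset.card_insert_le _ _).trans (by simp),
    hb₀, IsROP.X' l, X_ne_zero l, ?_, ?_⟩
  · rw [List.foldr_cons, List.foldr_nil, hE', map_sum]
    have hsum : ∀ b : Fin 4, pderiv k (rename (anfBlock (0 + 1) (1 - b)) (anf K (0 + 1)) * C (cb b)) =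
        (if b = b₀ then X l else 0) * C (cb b) := fun b => by
      rw [pderiv_mul, pderiv_C, mul_zero, add_zero, hdk]
    rw [Finset.sum_congr rfl fun b _ => hsum b,
      Finset.sum_eq_single_of_mem b₀ (Finset.mem_univ _) (fun b _ hb => by rw [if_neg hb, zero_mul]),
      if_pos rfl, map_mul, aeval_X, if_neg hlZ, algHom_C, MvPolynomial.algebraMap_eq, mul_comm]
  · rw [List.foldr_cons, List.foldr_nil, hk, hBk, pderiv_anf_succ, sub_sub_cancel, map_mul,
      ← hBk, hkillA, zero_mul]

/-- **Lemma 5.14, second case, inductive lift**: if all cross coefficients cancel, the combination is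
`Σ_b A_{1-b} · (Σ α ∂∂A_b)`; a nonzero block `b₀` is handled by the depth-`Δ` statement inside the block
(its clause `(∂_D ANF_Δ)|_{Z=0} = 0` kills the partner term `A_{b₀} · (…)^{(1-b₀)}`).
[cite: MediniShpilka2021, proof of Lemma 5.14 (arXiv p0029:L42-L60), lifted through Def 8] -/
theorem exists_kill_pderivs_of_cross_eq_zero_step (m : ℕ)
    (ih : ∀ α : Fin (4 ^ (m + 1 + 1)) → Fin (4 ^ (m + 1 + 1)) → K,
      (∑ i, ∑ j, C (α i j) * pderiv i (pderiv j (anf K (m + 1 + 1)))) ≠ 0 → ∃ (L : List (Fin (4 ^ (m + 1 + 1)))) (Z : Finset (Fin (4 ^ (m + 1 + 1)))) (c : K)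
      (S : Finset (Fin (4 ^ (m + 1 + 1)))) (Q : MvPolynomial (Fin (4 ^ (m + 1 + 1))) K),
      1 ≤ L.length ∧ L.length ≤ 2 ∧ Z.card ≤ 2 ∧ c ≠ 0 ∧ IsROP S Q ∧ Q ≠ 0 ∧
      aeval (fun w => if w ∈ Z then (0 : MvPolynomial (Fin (4 ^ (m + 1 + 1))) K) else X w)
        (L.foldr (fun w p => pderiv w p)
          (∑ i, ∑ j, C (α i j) * pderiv i (pderiv j (anf K (m + 1 + 1))))) = C c * Q ∧
      aeval (fun w => if w ∈ Z then (0 : MvPolynomial (Fin (4 ^ (m + 1 + 1))) K) else X w)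
        (L.foldr (fun w p => pderiv w p) (anf K (m + 1 + 1))) = 0)
    (α : Fin (4 ^ (m + 1 + 1 + 1)) → Fin (4 ^ (m + 1 + 1 + 1)) → K)
    (hγ : ∀ (b : Fin 4) (a a' : Fin (4 ^ (m + 1 + 1))),
      α (anfBlock (m + 1 + 1) b a) (anfBlock (m + 1 + 1) (1 - b) a') +
      α (anfBlock (m + 1 + 1) (1 - b) a') (anfBlock (m + 1 + 1) b a) = 0)
    (hf : (∑ i, ∑ j, C (α i j) * pderiv i (pderiv j (anf K (m + 1 + 1 + 1)))) ≠ 0) :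
    ∃ (L : List (Fin (4 ^ (m + 1 + 1 + 1)))) (Z : Finset (Fin (4 ^ (m + 1 + 1 + 1)))) (c : K)
      (S : Finset (Fin (4 ^ (m + 1 + 1 + 1)))) (Q : MvPolynomial (Fin (4 ^ (m + 1 + 1 + 1))) K),
      1 ≤ L.length ∧ L.length ≤ 2 ∧ Z.card ≤ 2 ∧ c ≠ 0 ∧ IsROP S Q ∧ Q ≠ 0 ∧
      aeval (fun w => if w ∈ Z then (0 : MvPolynomial (Fin (4 ^ (m + 1 + 1 + 1))) K) else X w)
        (L.foldr (fun w p => pderiv w p)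
          (∑ i, ∑ j, C (α i j) * pderiv i (pderiv j (anf K (m + 1 + 1 + 1))))) = C c * Q ∧
      aeval (fun w => if w ∈ Z then (0 : MvPolynomial (Fin (4 ^ (m + 1 + 1 + 1))) K) else X w)
        (L.foldr (fun w p => pderiv w p) (anf K (m + 1 + 1 + 1))) = 0 := by
  classical
  have hE := sum_pderiv_pderiv_anf_succ_eq (K := K) (m + 1 + 1) α
  rw [cross_sum_eq_zero (m + 1 + 1) α hγ, add_zero] at hE
  -- a block with a nonzero combination
  obtain ⟨b₀, hb₀⟩ : ∃ b₀ : Fin 4, (∑ a, ∑ a', C (α (anfBlock (m + 1 + 1) b₀ a) (anfBlock (m + 1 + 1) b₀ a')) *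
      pderiv a (pderiv a' (anf K (m + 1 + 1)))) ≠ 0 := by
    by_contra hall
    push Not at hall
    apply hf
    rw [hE]
    simp [hall]
  obtain ⟨L', Z', c, S', Q', hL1, hL2, hZ', hc, hROP', hQ', hform', hanf'⟩ :=
    ih (fun a a' => α (anfBlock (m + 1 + 1) b₀ a) (anfBlock (m + 1 + 1) b₀ a')) hb₀
  have hL'ne : L' ≠ [] := by
    intro h; rw [h] at hL1; simp at hL1
  obtain ⟨hf1, hf2, hf3, hf4⟩ := add_two_ne_self b₀
  -- block-`b₀`-freeness of the other factors
  have hA1 : ∀ d, pderiv (anfBlock (m + 1 + 1) b₀ d) (rename (anfBlock (m + 1 + 1) (1 - b₀)) (anf K (m + 1 + 1))) = 0 :=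
    fun d => pderiv_anfBlock_rename_of_ne K (one_sub_ne_self b₀) d _
  have hR1 : ∀ d, pderiv (anfBlock (m + 1 + 1) b₀ d) (rename (anfBlock (m + 1 + 1) (1 - b₀))
      (∑ a, ∑ a', C (α (anfBlock (m + 1 + 1) (1 - b₀) a) (anfBlock (m + 1 + 1) (1 - b₀) a')) *
        pderiv a (pderiv a' (anf K (m + 1 + 1))))) = 0 :=
    fun d => pderiv_anfBlock_rename_of_ne K (one_sub_ne_self b₀) d _
  have hfar : ∀ (b₁ b₂ : Fin 4), b₁ ≠ b₀ → b₂ ≠ b₀ → ∀ (R : MvPolynomial (Fin (4 ^ (m + 1 + 1))) K),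
      (L'.map (anfBlock (m + 1 + 1) b₀)).foldr (fun w p => pderiv w p)
        (rename (anfBlock (m + 1 + 1) b₁) (anf K (m + 1 + 1)) * rename (anfBlock (m + 1 + 1) b₂) R) = 0 :=
    fun b₁ b₂ h1 h2 R => foldr_pderiv_map_anfBlock_eq_zero (m + 1 + 1) b₀ L' hL'ne _
      (pderiv_anfBlock_mul_rename_of_ne (m + 1 + 1) h1 h2 _ _)
  refine ⟨L'.map (anfBlock (m + 1 + 1) b₀), Z'.image (anfBlock (m + 1 + 1) b₀), c,
    Finset.univ.image (anfBlock (m + 1 + 1) (1 - b₀)) ∪ S'.image (anfBlock (m + 1 + 1) b₀),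
    rename (anfBlock (m + 1 + 1) (1 - b₀)) (anf K (m + 1 + 1)) * rename (anfBlock (m + 1 + 1) b₀) Q',
    by rw [List.length_map]; exact hL1, by rw [List.length_map]; exact hL2,
    Finset.card_image_le.trans hZ', hc,
    IsROP.mul' ((isROP_anf K (m + 1 + 1)).rename _ (anfBlock_injective _ _))
      (hROP'.rename _ (anfBlock_injective _ _)) (disjoint_image_anfBlock _ (one_sub_ne_self b₀) _ _),
    mul_ne_zero (rename_anfBlock_ne_zero _ _ (anf_ne_zero K (m + 1 + 1)))
      (rename_anfBlock_ne_zero _ _ hQ'),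
    ?_, ?_⟩
  · rw [hE, foldr_pderiv_sum, sum_fin_four_eq_blockwise b₀]
    simp only [sub_sub_cancel]
    rw [foldr_pderiv_map_anfBlock_mul_rename (m + 1 + 1) b₀ L' _ hA1,
      mul_comm (rename (anfBlock (m + 1 + 1) b₀) (anf K (m + 1 + 1))),
      foldr_pderiv_map_anfBlock_mul_rename (m + 1 + 1) b₀ L' _ hR1,
      hfar (1 - (b₀ + 2)) (b₀ + 2) hf3 hf1, hfar (b₀ + 2) (1 - (b₀ + 2)) hf1 hf3, add_zero, add_zero,
      map_add, map_mul, map_mul, aeval_kill_rename_anfBlock, hform', aeval_kill_rename_anfBlock, hanf',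
      map_zero, mul_zero, add_zero, aeval_kill_image_rename_anfBlock_of_ne (m + 1 + 1) (one_sub_ne_self b₀),
      map_mul, rename_C]
    ring
  · rw [anf_succ_eq_block K (m + 1 + 1) b₀, foldr_pderiv_add,
      mul_comm (rename (anfBlock (m + 1 + 1) b₀) (anf K (m + 1 + 1))),
      foldr_pderiv_map_anfBlock_mul_rename (m + 1 + 1) b₀ L' _ hA1,
      hfar (b₀ + 2) (1 - (b₀ + 2)) hf1 hf3, add_zero, map_mul, aeval_kill_rename_anfBlock, hanf', map_zero,
      mul_zero]

end CaseB

/-! ### Lemma 5.14 (kernel form) -/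

section Lemma514

variable {K : Type*} [Field K]

/-- **MS21 Lemma 5.14 (`lem:hitSecondDeriv`), kernel form.** For `Δ ≥ 2` (written `m + 2`) and a
nonzero combination `P = Σ_{i,j} α_{ij} ∂²ANF_Δ/∂x_i∂x_j`, there are coordinates `D` (`1 ≤ |D| ≤ 2`),
killed variables `Z` (`|Z| ≤ 2`), `c ≠ 0` and a nonzero read-once `Q` with `(∂_D P)|_{Z=0} = c · Q`;
moreover `(∂_D ANF_Δ)|_{Z=0} = 0`. (Printed: `(∂_D f)|_{Z=0} = β_{ij} (∂^{2+|D|}ANF/∂x_i∂x_j∂D)|_{Z=0} ≠ 0`,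
a product of variable-disjoint ROPs; here packaged as one ROP.)
[cite: MediniShpilka2021, Lemma 5.14 (arXiv p0029:L27-L60)] -/
theorem exists_kill_pderivs_eq_C_mul_rop :
    ∀ (m : ℕ) (α : Fin (4 ^ (m + 1 + 1)) → Fin (4 ^ (m + 1 + 1)) → K),
      (∑ i, ∑ j, C (α i j) * pderiv i (pderiv j (anf K (m + 1 + 1)))) ≠ 0 → ∃ (L : List (Fin (4 ^ (m + 1 + 1)))) (Z : Finset (Fin (4 ^ (m + 1 + 1)))) (c : K)
      (S : Finset (Fin (4 ^ (m + 1 + 1)))) (Q : MvPolynomial (Fin (4 ^ (m + 1 + 1))) K),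
      1 ≤ L.length ∧ L.length ≤ 2 ∧ Z.card ≤ 2 ∧ c ≠ 0 ∧ IsROP S Q ∧ Q ≠ 0 ∧
      aeval (fun w => if w ∈ Z then (0 : MvPolynomial (Fin (4 ^ (m + 1 + 1))) K) else X w)
        (L.foldr (fun w p => pderiv w p)
          (∑ i, ∑ j, C (α i j) * pderiv i (pderiv j (anf K (m + 1 + 1))))) = C c * Q ∧
      aeval (fun w => if w ∈ Z then (0 : MvPolynomial (Fin (4 ^ (m + 1 + 1))) K) else X w)
        (L.foldr (fun w p => pderiv w p) (anf K (m + 1 + 1))) = 0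
  | 0, α, hf => by
      classical
      by_cases hA : ∃ (b : Fin 4) (a₀ a₁ : Fin (4 ^ (0 + 1))),
          α (anfBlock (0 + 1) b a₀) (anfBlock (0 + 1) (1 - b) a₁) +
            α (anfBlock (0 + 1) (1 - b) a₁) (anfBlock (0 + 1) b a₀) ≠ 0
      · obtain ⟨b, a₀, a₁, h⟩ := hA
        exact exists_kill_pderivs_of_cross_ne_zero 0 α b a₀ a₁ h
      · push Not at hA
        exact exists_kill_pderivs_of_cross_eq_zero_base α hA hf
  | m + 1, α, hf => by
      classical
      by_cases hA : ∃ (b : Fin 4) (a₀ a₁ : Fin (4 ^ (m + 1 + 1))),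
          α (anfBlock (m + 1 + 1) b a₀) (anfBlock (m + 1 + 1) (1 - b) a₁) +
            α (anfBlock (m + 1 + 1) (1 - b) a₁) (anfBlock (m + 1 + 1) b a₀) ≠ 0
      · obtain ⟨b, a₀, a₁, h⟩ := hA
        exact exists_kill_pderivs_of_cross_ne_zero (m + 1) α b a₀ a₁ h
      · push Not at hA
        exact exists_kill_pderivs_of_cross_eq_zero_step m (exists_kill_pderivs_eq_C_mul_rop m) α hA hf

end Lemma514

/-! ### Lemma 5.15 / L2D: hitting second-order derivative combinations of an ANF orbit -/

section Lemma515

variable {K : Type*} [Field K] {n : ℕ}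

/-- **Hitting `(Σ_{i,j} α_{ij} ∂_i∂_j ANF_Δ)(Ax + b)`** (MS21 Lemma 5.15 in the consortium's L2D shape,
one order above x5's `bind₁_affSubst_sum_C_mul_pderiv_anf_ne_zero`): for a nonzero combination and
an invertible affine `(A, b)`, every `B`-independent `G` with `B ≥ t + 5`, `4^Δ ≤ 2^t` (so `B = 2Δ+5`
as printed) satisfies `(…)(Ax+b) ∘ G ≠ 0`. Every field, every `Δ` (`Δ ≤ 1`: the combination is a
nonzero constant). Route: Lemma 5.14 (`exists_kill_pderivs_eq_C_mul_rop`) + t18's engine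
`bind₁_affSubst_ne_zero_of_kill_pderivs_eq_prod` (Lemma 3.8 dual derivatives, ≤ 2 derivative
blocks, ≤ 2 kill blocks, Thm 33 on the read-once factor with `≤ 4^Δ ≤ 2^t` leaves).
[cite: MediniShpilka2021, Lemma 5.15 (arXiv p0030:L1-L26)] -/
theorem bind₁_affSubst_sum_C_mul_pderiv_pderiv_anf_ne_zero {Δ t B c : ℕ}
    (α : Fin (4 ^ Δ) → Fin (4 ^ Δ) → K)
    (hα : (∑ i, ∑ j, C (α i j) * pderiv i (pderiv j (anf K Δ))) ≠ 0) (h : 4 ^ Δ ≤ n)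
    {A : Matrix (Fin n) (Fin n) K} (hA : IsUnit A.det) (b : Fin n → K) (ht : 4 ^ Δ ≤ 2 ^ t)
    (G : Fin n → MvPolynomial (Fin B × (Fin c ⊕ Unit)) K) (hG : IsIndependent B G)
    (hB : t + 5 ≤ B) :
    bind₁ G (affSubst h A b (∑ i, ∑ j, C (α i j) * pderiv i (pderiv j (anf K Δ)))) ≠ 0 := by
  classical
  cases Δ with
  | zero =>
      -- `ANF_0 = x_1`: every second derivative vanishes
      have h0 : ∀ i j : Fin (4 ^ 0), pderiv i (pderiv j (anf K 0)) = 0 := by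
        intro i j
        simp only [anf]
        rw [pderiv_X_eq_ite]
        split_ifs <;> simp
      simp [h0] at hα
  | succ Δ =>
    cases Δ with
    | zero =>
        -- `ANF_1`: the combination is a nonzero constant
        have hC := sum_C_mul_pderiv_pderiv_anf_one_eq_C (K := K) α
        have hc : coeff 0 (∑ i, ∑ j, C (α i j) * pderiv i (pderiv j (anf K (0 + 1)))) ≠ 0 := by
          intro h0
          apply hα
          rw [hC, h0, C_0]
        rw [hC, affSubst_C, bind₁_C_right, Ne, C_eq_zero]
        exact hc
    | succ m =>
        obtain ⟨L, Z, c₀, S, Q, -, hL2, hZ, hc, hROP, hQ, hform, -⟩ :=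
          exists_kill_pderivs_eq_C_mul_rop m α hα
        have hS : S.card ≤ 2 ^ t := (Finset.card_le_univ S).trans (by rwa [Fintype.card_fin])
        refine bind₁_affSubst_ne_zero_of_kill_pderivs_eq_prod (ι := Unit) (t := t) (a := L.length)
          (∑ i, ∑ j, C (α i j) * pderiv i (pderiv j (anf K (m + 1 + 1)))) L.get Z {()} (fun _ => Q)
          (fun _ => S) c₀ (fun _ _ => hROP) (fun _ _ => hS) ?_ ?_ h hA b G hG ?_
        · rw [List.ofFn_get, hform, Finset.prod_singleton]
        · rw [Finset.prod_singleton]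
          exact mul_ne_zero (by rwa [Ne, C_eq_zero]) hQ
        · omega

/-- **MS21 Lemma 5.15 (`lem:pitDerivRoanf`), printed form.** For `f = ANF_Δ(Ax + b)` with `(A, b)`
invertible affine and vectors `w, u`: if `∂²f/∂w∂u ≠ 0` then `(∂²f/∂w∂u) ∘ G ≠ 0` for every
`B`-independent `G` with `B ≥ t + 5`, `4^Δ ≤ 2^t` (`B = 2Δ + 5` as printed; the printed `Δ ≥ 2` is
not needed). Chain rule (`dirDeriv_affSubst`, Lemma 3.8) + the L2D statement above.
[cite: MediniShpilka2021, Lemma 5.15 (arXiv p0030:L1-L26)] -/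
theorem bind₁_dirDeriv_dirDeriv_affSubst_anf_ne_zero {Δ t B c : ℕ} (h : 4 ^ Δ ≤ n)
    {A : Matrix (Fin n) (Fin n) K} (hA : IsUnit A.det) (b : Fin n → K) (w u : Fin n → K)
    (hne : (∑ j, C (w j) * pderiv j (∑ j', C (u j') * pderiv j' (affSubst h A b (anf K Δ)))) ≠ 0)
    (ht : 4 ^ Δ ≤ 2 ^ t) (G : Fin n → MvPolynomial (Fin B × (Fin c ⊕ Unit)) K)
    (hG : IsIndependent B G) (hB : t + 5 ≤ B) :
    bind₁ G (∑ j, C (w j) * pderiv j (∑ j', C (u j') * pderiv j' (affSubst h A b (anf K Δ)))) ≠ 0 := by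
  classical
  have key : (∑ j, C (w j) * pderiv j (∑ j', C (u j') * pderiv j' (affSubst h A b (anf K Δ)))) =
      affSubst h A b (∑ i, ∑ j, C ((A.mulVec w) (Fin.castLE h i) * (A.mulVec u) (Fin.castLE h j)) *
        pderiv i (pderiv j (anf K Δ))) := by
    rw [dirDeriv_affSubst, dirDeriv_affSubst]
    congr 1
    refine Finset.sum_congr rfl fun i _ => ?_
    rw [map_sum, Finset.mul_sum]
    refine Finset.sum_congr rfl fun j _ => ?_
    rw [pderiv_C_mul, ← mul_assoc, ← map_mul]
  rw [key] at hne ⊢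
  refine bind₁_affSubst_sum_C_mul_pderiv_pderiv_anf_ne_zero _ ?_ h hA b ht G hG hB
  intro h0
  apply hne
  rw [h0]
  unfold affSubst
  rw [map_zero]

end Lemma515




end MS2021

end Literature.Computability.AlgebraicComplexity

end
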